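import Literature.NumberTheory.EllipticCurves.TwistedLValueSeries
import Literature.NumberTheory.EllipticCurves.WildCharacterFamily
import Literature.NumberTheory.EllipticCurves.PAdicLFunctionProofs
import Literature.NumberTheory.Sieve.LargeSieveCharacters
import Mathlib.Analysis.SumIntegralComparisons
import Mathlib.Analysis.SpecialFunctions.Gamma.Basic
import Mathlib.MeasureTheory.Integral.Gamma
import HarnessLib

/-!
# The first moment of the twisted `L`-values over the wild characters of conductor `p^m`

Topic `NumberTheory/EllipticCurves` (trunk EllArithM; the analytic heart of
`padicLFunction_ne_zero`, replacing Rohrlich's theorem `Rohrlich1984_nonvanishing_twists`).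
Let `f = ∑ aₙ qⁿ ∈ S_2(Γ₀(N))` with `a₁ = 1` and `|aₙ| ≤ C n^θ` for some `θ < 2/3`, let
`g = ∑ bₙ qⁿ ∈ S_2(Γ₀(N))` with `f(-1/(Nτ)) = N τ² g(τ)` (`IsFrickePair`; e.g. `g = w_N f`, or
`g = ε f` for a `w_N`-eigenform) and `|bₙ| ≤ C' n^{θ'}` for some `θ' ≤ 1` (Hecke's trivial bound
suffices); let `p ∤ N`. For the wild characters `χ ∈ 𝔛_m` of conductor `p^m` (`wildChars`:
primitive, even, of `p`-power order) consider the weighted **first moment**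

`M_m = ∑_{χ ∈ 𝔛_m} (τ(χ)/p^m) ∑_{a mod p^m} χ̄(a) {∞, a/p^m}_f`
`    = ∑_{χ ∈ 𝔛_m} L(f, χ, 1)` (Birch's formula; `τ(χ)τ(χ̄) = p^m` for even `χ`).

By the two-sided series (`twistedSymbolSum_inv_eq_dampedTwist_of_isFrickePair`) with
`Y = p^{-am}` (`3/2 < a < 1/θ`), `Y' = 1/(N p^{2m} Y)`,

`M_m = D_f(A, Y) - (1/p^m) D_g(B, Y')`, `A(n) = ∑_χ χ(n)`, `B(n) = ∑_χ χ(N) τ(χ)² χ̄(n)`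

(`sum_wildChars_twistedSymbolSum_eq`). The term `n = 1` of `D_f(A, Y)` is `#𝔛_m e^{-2πY}`. All
other terms are small: `A(n) = 0` unless `n^{2(p-1)} ≡ 1 (mod p^{m-1})` (orthogonality,
`WildCharacterFamily`), a sparse set of integers all `≥ p^{(m-1)/(2(p-1))}`, which with
`|aₙ| ≤ C n^θ` gives `‖D_f(A,Y) - #𝔛_m e^{-2πY}‖ = O(#𝔛_m p^{m(aθ - 1)})`
(`norm_dampedTwist_sum_wildChars_sub_le`); and `|B(n)| ≤ 16p³ #𝔛_m p^{m/2}` by the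
Kloosterman bound for the family average of the root numbers, giving
`‖(1/p^m) D_g(B,Y')‖ = O(#𝔛_m p^{m((2-a)θ' - 1/2)})` (`norm_dampedTwist_dual_le`). Hence

* `exists_wildChars_twistedSymbolSum_ne_zero`: **for all large `m` some `χ ∈ 𝔛_m` has
  `∑_a χ(a){∞, a/p^m}_f ≠ 0`** (i.e. `L(f, χ̄, 1) ≠ 0`).

This is the non-vanishing input for `L_p(E, T) ≠ 0`: if `L_p = 0`, interpolation kills the
symbol sums of *all* wild characters of *all* conductors `p^m` (a Galois-stable family, so no
algebraicity argument is needed, unlike Rohrlich's theorem for individual `χ`). Since `(f, w_N f)`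
is a Fricke pair for *every* `f ∈ S_2(Γ₀(N))` and Hecke's bound `bₙ = O(n)` holds for every cusp
form of weight `2`, no Atkin–Lehner theory (`w_N f = ± f` for newforms) is needed either.

## Contents

* Real analysis: `sum_range_rpow_mul_exp_le` (`∑_{j≥1} j^{θ-1}e^{-uj} ≤ 1 + Γ(θ)u^{-θ}`,
  integral test), `sum_range_indicator_rpow_mul_exp_le` (sums over sparse residue classes).
* `sum_mul_dampedTwist`, `sum_wildChars_twistedSymbolSum_eq` (the moment identity).
* `norm_dampedTwist_sum_wildChars_sub_le`, `norm_dampedTwist_dual_le` (the two error terms).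
* `exists_wildChars_twistedSymbolSum_ne_zero` (asymptotics `δ_m → 0`, `e^{-2πY_m} → 1`).

## References

* D. E. Rohrlich, *On `L`-functions of elliptic curves and cyclotomic towers*, Invent. Math. 75
  (1984), 409–423 (the method: approximate functional equation and an average over characters
  of `p`-power conductor; there the Galois average and Theorem p. 409 for individual `χ`).
* B. Mazur, J. Tate, J. Teitelbaum, Invent. Math. 84 (1986), §I.13–I.14.
* R. Greenberg, *Iwasawa theory for elliptic curves*, LNM 1716 (1999), §1 (`L_p(E,T) ≠ 0`).
-/

noncomputable section

open scoped BigOperators Real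
open Finset Filter Topology Set MeasureTheory

namespace Literature.NumberTheory.EllipticCurves

/-! ### Real analysis: `∑_{j ≥ 1} j^{θ-1} e^{-uj} ≤ 1 + Γ(θ) u^{-θ}` and sums over sparse classes -/

section Analysis

/-- The comparison function `G(x) = x^{θ-1} e^{-ux}`. [folklore] -/
private def G (θ u x : ℝ) : ℝ := x ^ (θ - 1) * Real.exp (-u * x)

/-- `G ≥ 0` on `[0, ∞)`. [folklore] -/
private theorem G_nonneg (θ u : ℝ) {x : ℝ} (hx : 0 ≤ x) : 0 ≤ G θ u x :=
  mul_nonneg (Real.rpow_nonneg hx _) (Real.exp_pos _).le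

/-- `G` is antitone on `(0, ∞)` for `θ ≤ 1`, `u ≥ 0`. [folklore] -/
private theorem G_antitone {θ u : ℝ} (hθ1 : θ ≤ 1) (hu : 0 ≤ u) {x y : ℝ} (hx : 0 < x) (hxy : x ≤ y) :
    G θ u y ≤ G θ u x := by
  unfold G
  refine mul_le_mul (Real.rpow_le_rpow_of_nonpos hx hxy (by linarith)) ?_ (Real.exp_pos _).le
    (Real.rpow_nonneg hx.le _)
  exact Real.exp_le_exp.mpr (by nlinarith)

/-- `G(x) ≤ x^{θ-1}`. [folklore] -/
private theorem G_le_rpow (θ u : ℝ) (hu : 0 ≤ u) {x : ℝ} (hx : 0 ≤ x) : G θ u x ≤ x ^ (θ - 1) := by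
  unfold G
  refine mul_le_of_le_one_right (Real.rpow_nonneg hx _) ?_
  rw [Real.exp_le_one_iff]
  nlinarith

/-- `∫₀^∞ x^{θ-1} e^{-ux} dx = Γ(θ) u^{-θ}` and integrability (Mathlib). [folklore] -/
private theorem integral_G {θ u : ℝ} (hθ : 0 < θ) (hu : 0 < u) :
    IntegrableOn (G θ u) (Ioi 0) ∧ ∫ x in Ioi 0, G θ u x = Real.Gamma θ * u ^ (-θ) := by
  constructor
  · have h := integrableOn_rpow_mul_exp_neg_mul_rpow (s := θ - 1) (p := 1) (b := u) (by linarith)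
      le_rfl hu
    refine h.congr_fun (fun x hx ↦ ?_) measurableSet_Ioi
    simp [G, Real.rpow_one]
  · have h := Real.integral_rpow_mul_exp_neg_mul_Ioi hθ hu
    rw [show (fun t : ℝ ↦ t ^ (θ - 1) * Real.exp (-(u * t))) = G θ u by
      funext t; simp [G, neg_mul]] at h
    rw [h, one_div, Real.inv_rpow hu.le, Real.rpow_neg hu.le, mul_comm]

/-- **`∑_{1 ≤ j ≤ M} j^{θ-1} e^{-uj} ≤ 1 + Γ(θ) u^{-θ}`** for `0 < θ ≤ 1`, `u > 0` (integral test: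
the terms `j ≥ 2` are bounded by `∫₁^∞ x^{θ-1} e^{-ux} dx ≤ Γ(θ) u^{-θ}`, the term `j = 1` by `1`).
[folklore] -/
theorem sum_range_rpow_mul_exp_le {θ u : ℝ} (hθ : 0 < θ) (hθ1 : θ ≤ 1) (hu : 0 < u) (M : ℕ) :
    ∑ j ∈ Finset.range M, ((j + 1 : ℕ) : ℝ) ^ (θ - 1) * Real.exp (-u * (j + 1 : ℕ)) ≤
      1 + Real.Gamma θ * u ^ (-θ) := by
  have hG := integral_G hθ hu
  have hRHS : 0 ≤ Real.Gamma θ * u ^ (-θ) := by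
    have := Real.Gamma_pos_of_pos hθ; positivity
  rcases Nat.eq_zero_or_pos M with rfl | hM
  · simp; linarith
  -- split off `j = 0`
  rw [Finset.range_eq_Ico, ← Finset.insert_Ico_succ_left_eq_Ico hM, Finset.sum_insert (by simp)]
  refine add_le_add ?_ ?_
  · -- `G(1) = e^{-u} ≤ 1`
    simp only [zero_add, Nat.cast_one, Real.one_rpow, one_mul, mul_one]
    exact Real.exp_le_one_iff.mpr (by linarith)
  · -- the terms `j + 1 = 2, …, M` are bounded by `∫_1^M G ≤ ∫_0^∞ G`
    have hanti : AntitoneOn (G θ u) (Set.Icc (1 : ℕ) M) := by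
      intro x hx y hy hxy
      simp only [Nat.cast_one, Set.mem_Icc] at hx hy
      exact G_antitone hθ1 hu.le (by linarith) hxy
    have h1 : ∑ j ∈ Finset.Ico (Order.succ 0) M, ((j + 1 : ℕ) : ℝ) ^ (θ - 1) * Real.exp (-u * (j + 1 : ℕ)) =
        ∑ j ∈ Finset.Ico 1 M, G θ u ((j + 1 : ℕ) : ℝ) := by
      rfl
    rw [h1]
    refine (AntitoneOn.sum_le_integral_Ico hM hanti).trans ?_
    rw [intervalIntegral.integral_of_le (by exact_mod_cast hM)]
    calc ∫ x in Ioc ((1 : ℕ) : ℝ) M, G θ u x ≤ ∫ x in Ioi 0, G θ u x := by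
          refine setIntegral_mono_set hG.1 ?_ ?_
          · exact (ae_restrict_iff' measurableSet_Ioi).mpr (ae_of_all _ fun x hx ↦ G_nonneg θ u (le_of_lt hx))
          · exact ae_of_all _ fun x hx ↦ lt_trans (Nat.cast_pos.mpr Nat.one_pos) hx.1
      _ = _ := hG.2

/-- Summability of `∑_{n ≥ 1} n^{θ-1} e^{-un}` (terms bounded by the geometric `e^{-un}`). [folklore] -/
theorem summable_rpow_mul_exp {θ u : ℝ} (hθ1 : θ ≤ 1) (hu : 0 < u) :
    Summable fun n : ℕ ↦ (n : ℝ) ^ (θ - 1) * Real.exp (-u * n) := by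
  have hgeom : Summable fun n : ℕ ↦ Real.exp (-u) ^ n :=
    summable_geometric_of_lt_one (Real.exp_pos _).le (Real.exp_lt_one_iff.mpr (by linarith))
  refine Summable.of_norm_bounded_eventually_nat hgeom ?_
  filter_upwards [eventually_ge_atTop 1] with n hn
  rw [Real.norm_of_nonneg (mul_nonneg (Real.rpow_nonneg (Nat.cast_nonneg _) _) (Real.exp_pos _).le),
    ← Real.exp_nat_mul, mul_comm (n : ℝ)]
  refine mul_le_of_le_one_left (Real.exp_pos _).le ?_
  exact Real.rpow_le_one_of_one_le_of_nonpos (by exact_mod_cast hn) (by linarith)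

/-- **Sums of `n^{θ-1} e^{-cn}` over a sparse set of residues.** Let `q ≥ 1`, `R ⊆ ℤ/qℤ`,
`n₀ > 0`, and let `S ⊆ ℕ` be contained in the classes of `R` mod `q` and such that every
`n ∈ S` with `n ≥ 2` exceeds `n₀`. Then for `0 < θ ≤ 1`, `c > 0` and every `M`,
`∑_{n < M, n ∈ S, n ≥ 2} n^{θ-1} e^{-cn} ≤ #R · (n₀^{θ-1} + q^{θ-1} (1 + Γ(θ) (cq)^{-θ}))`:
in each class the first term is at most `n₀^{θ-1}` and the others are at most
`∑_{j ≥ 1} (qj)^{θ-1} e^{-cqj}`. [folklore] -/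
theorem sum_range_indicator_rpow_mul_exp_le {θ c : ℝ} (hθ : 0 < θ) (hθ1 : θ ≤ 1) (hc : 0 < c)
    {q : ℕ} (hq : 0 < q) (R : Finset (ZMod q)) {n₀ : ℝ} (hn₀ : 0 < n₀) (S : ℕ → Prop)
    [DecidablePred S] (hS₁ : ∀ n, S n → (n : ZMod q) ∈ R) (hS₂ : ∀ n, S n → 2 ≤ n → n₀ ≤ n)
    (M : ℕ) :
    ∑ n ∈ Finset.range M, (if S n ∧ 2 ≤ n then (n : ℝ) ^ (θ - 1) * Real.exp (-c * n) else 0) ≤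
      R.card * (n₀ ^ (θ - 1) + (q : ℝ) ^ (θ - 1) * (1 + Real.Gamma θ * (c * q) ^ (-θ))) := by
  haveI : NeZero q := ⟨hq.ne'⟩
  have hqr : (0 : ℝ) < q := Nat.cast_pos.mpr hq
  set T : ℕ → ℝ := fun n ↦ if S n ∧ 2 ≤ n then (n : ℝ) ^ (θ - 1) * Real.exp (-c * n) else 0 with hT
  have hT0 : ∀ n, 0 ≤ T n := fun n ↦ by
    simp only [hT]; split_ifs
    · exact G_nonneg θ c (Nat.cast_nonneg _)
    · exact le_rfl
  set B : ℝ := n₀ ^ (θ - 1) + (q : ℝ) ^ (θ - 1) * (1 + Real.Gamma θ * (c * q) ^ (-θ)) with hB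
  have hB0 : 0 ≤ B := by
    have := Real.Gamma_pos_of_pos hθ
    positivity
  -- extend the range to a multiple of `q`
  set J := M / q + 1 with hJ
  have hMJ : M ≤ q * J := by
    rw [hJ, mul_add, mul_one]
    have := Nat.div_add_mod M q
    have := Nat.mod_lt M hq
    nlinarith
  calc ∑ n ∈ Finset.range M, T n ≤ ∑ n ∈ Finset.range (q * J), T n :=
        Finset.sum_le_sum_of_subset_of_nonneg (Finset.range_mono hMJ) fun n _ _ ↦ hT0 n
    _ = ∑ r ∈ Finset.range q, ∑ j ∈ Finset.range J, T (r + q * j) := LFunctions.sum_range_mul_eq_sum_sum q J T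
    _ ≤ ∑ r ∈ Finset.range q, (if (r : ZMod q) ∈ R then B else 0) := by
        refine Finset.sum_le_sum fun r hr ↦ ?_
        rw [Finset.mem_range] at hr
        by_cases hrR : (r : ZMod q) ∈ R
        · rw [if_pos hrR]
          -- split off `j = 0`
          rw [Finset.range_eq_Ico, ← Finset.insert_Ico_succ_left_eq_Ico (Nat.succ_pos _),
            Finset.sum_insert (by simp), mul_zero, add_zero]
          refine add_le_add ?_ ?_
          · -- the term `j = 0`
            simp only [hT]
            split_ifs with h
            · calc (r : ℝ) ^ (θ - 1) * Real.exp (-c * r) ≤ (r : ℝ) ^ (θ - 1) :=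
                    G_le_rpow θ c hc.le (Nat.cast_nonneg _)
                _ ≤ n₀ ^ (θ - 1) :=
                    Real.rpow_le_rpow_of_nonpos hn₀ (hS₂ r h.1 h.2) (by linarith)
            · exact Real.rpow_nonneg hn₀.le _
          · -- the terms `j ≥ 1`: compare with `G(qj)`
            calc ∑ j ∈ Finset.Ico 1 J, T (r + q * j)
                ≤ ∑ j ∈ Finset.Ico 1 J, G θ c ((q : ℝ) * j) := by
                  refine Finset.sum_le_sum fun j hj ↦ ?_
                  rw [Finset.mem_Ico] at hj
                  have hqj : (0 : ℝ) < q * j := by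
                    have : (1 : ℝ) ≤ j := by exact_mod_cast hj.1
                    positivity
                  simp only [hT]
                  split_ifs
                  · refine G_antitone hθ1 hc.le hqj ?_
                    push_cast; linarith [(Nat.cast_nonneg r : (0 : ℝ) ≤ r)]
                  · exact G_nonneg θ c hqj.le
              _ = (q : ℝ) ^ (θ - 1) * ∑ j ∈ Finset.range (J - 1),
                    (((j + 1 : ℕ) : ℝ) ^ (θ - 1) * Real.exp (-(c * q) * (j + 1 : ℕ))) := by
                  rw [Finset.mul_sum, Finset.sum_Ico_eq_sum_range]
                  refine Finset.sum_congr rfl fun j _ ↦ ?_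
                  simp only [G]
                  rw [Real.mul_rpow hqr.le (by positivity)]
                  push_cast
                  ring_nf
              _ ≤ (q : ℝ) ^ (θ - 1) * (1 + Real.Gamma θ * (c * q) ^ (-θ)) :=
                  mul_le_mul_of_nonneg_left (sum_range_rpow_mul_exp_le hθ hθ1 (by positivity) _)
                    (Real.rpow_nonneg hqr.le _)
        · rw [if_neg hrR]
          refine (Finset.sum_eq_zero fun j _ ↦ ?_).le
          simp only [hT]
          rw [if_neg]
          rintro ⟨hSj, -⟩
          apply hrR
          have := hS₁ _ hSj
          push_cast at this
          rwa [ZMod.natCast_self, zero_mul, add_zero] at this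
    _ = R.card * B := by
        rw [← LFunctions.sum_zmod_eq_sum_range (fun x : ZMod q ↦ if x ∈ R then B else 0), ← Finset.sum_filter,
          Finset.filter_mem_eq_inter, Finset.univ_inter, Finset.sum_const, nsmul_eq_mul]

end Analysis

/-! ### The moment identity -/

section MomentIdentity

open ModularForms UpperHalfPlane

variable {N : ℕ} [NeZero N] (f : CuspForm (CongruenceSubgroup.Gamma0 N) 2)

omit [NeZero N] in
/-- **Linearity of the damped twisted sums in the weight** over finite families of bounded
weights. [folklore] -/
theorem sum_mul_dampedTwist {ι : Type*} (s : Finset ι) (c : ι → ℂ) (w : ι → ℕ → ℂ) {B : ℝ}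
    (hw : ∀ i n, ‖w i n‖ ≤ B) {y : ℝ} (hy : 0 < y) :
    ∑ i ∈ s, c i * dampedTwist f (w i) y = dampedTwist f (fun n ↦ ∑ i ∈ s, c i * w i n) y := by
  have h : ∀ i ∈ s, HasSum (fun n : ℕ ↦ c i * (w i n * cuspCoeff f n *
      (Real.exp (-(2 * Real.pi * n) * y) / n : ℝ))) (c i * dampedTwist f (w i) y) := fun i _ ↦
    ((summable_dampedTwist f (hw i) hy).hasSum).mul_left _
  rw [← (hasSum_sum h).tsum_eq, dampedTwist]
  refine tsum_congr fun n ↦ ?_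
  rw [Finset.sum_mul, Finset.sum_mul]
  exact Finset.sum_congr rfl fun i _ ↦ by ring

variable {p : ℕ} [Fact p.Prime]

/-- The Gauss sum `τ(χ)` for `e(x/p^m)`. -/
local notation "τ" => fun (χ : DirichletCharacter ℂ _) ↦ gaussSum χ ZMod.stdAddChar

/-- **The first-moment identity.** Let `f, g ∈ S_2(Γ₀(N))` with `f(-1/(Nτ)) = N τ² g(τ)`
(a Fricke pair, e.g. `g = w_N f`), `p ∤ N`, `m ≥ 1`, `Y > 0`, `Y' = 1/(N p^{2m} Y)`. Summing the
two-sided series (`twistedSymbolSum_inv_eq_dampedTwist_of_isFrickePair`) against the weights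
`τ(χ)/p^m = τ(χ̄)⁻¹` over the wild characters `χ ∈ 𝔛_m` (even, so `τ(χ)τ(χ̄) = p^m`,
`Literature.NumberTheory.Sieve.LargeSieve.gaussSum_mul_gaussSum_inv`):
`∑_{χ ∈ 𝔛_m} (τ(χ)/p^m) ∑_a χ(a){∞, a/p^m}_f = D_f(A, Y) - (1/p^m) D_g(B, Y')` with
`A(n) = ∑_{χ} χ(n)` and `B(n) = ∑_{χ} χ(N) τ(χ)² χ̄(n)` (Rohrlich 1984, §3, the Galois average;
here the average over the full family `𝔛_m`). [folklore] -/
theorem sum_wildChars_twistedSymbolSum_eq {g : CuspForm (CongruenceSubgroup.Gamma0 N) 2}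
    (hW : IsFrickePair N f g) (hpN : ¬ p ∣ N) {m : ℕ} [NeZero (p ^ m)] {Y : ℝ} (hY : 0 < Y) :
    ∑ χ ∈ wildChars p m, gaussSum χ (ZMod.stdAddChar (N := p ^ m)) / (p ^ m : ℂ) *
        twistedSymbolSum f χ⁻¹ =
      dampedTwist f (fun n ↦ ∑ χ ∈ wildChars p m, χ n) Y -
        1 / (p ^ m : ℂ) * dampedTwist g (fun n ↦ ∑ χ ∈ wildChars p m,
          χ N * gaussSum χ (ZMod.stdAddChar (N := p ^ m)) ^ 2 * χ⁻¹ n) (1 / ((N : ℝ) * (p ^ m : ℕ) ^ 2 * Y)) := by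
  have hp : p.Prime := Fact.out
  have hmN : (p ^ m).Coprime N := Nat.Coprime.pow_left _ ((Nat.Prime.coprime_iff_not_dvd hp).mpr hpN)
  have hY' : 0 < 1 / ((N : ℝ) * (p ^ m : ℕ) ^ 2 * Y) := by
    have : (0 : ℝ) < N := Nat.cast_pos.mpr (NeZero.pos N)
    have : (0 : ℝ) < (p ^ m : ℕ) := Nat.cast_pos.mpr (NeZero.pos _)
    positivity
  have hpm : ((p ^ m : ℕ) : ℂ) ≠ 0 := Nat.cast_ne_zero.mpr (NeZero.ne _)
  -- termwise
  have hterm : ∀ χ ∈ wildChars p m,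
      gaussSum χ (ZMod.stdAddChar (N := p ^ m)) / (p ^ m : ℂ) * twistedSymbolSum f χ⁻¹ =
        (1 : ℂ) * dampedTwist f (fun n ↦ χ n) Y -
          1 / (p ^ m : ℂ) * ((χ N * gaussSum χ (ZMod.stdAddChar (N := p ^ m)) ^ 2) *
            dampedTwist g (fun n ↦ χ⁻¹ n) (1 / ((N : ℝ) * (p ^ m : ℕ) ^ 2 * Y))) := by
    intro χ hχ
    obtain ⟨hprim, heven, -⟩ := (mem_wildChars χ).mp hχ
    have h := twistedSymbolSum_inv_eq_dampedTwist_of_isFrickePair f g hW hmN hprim hY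
    have hgg := Literature.NumberTheory.Sieve.LargeSieve.gaussSum_mul_gaussSum_inv hprim
    have h1 : χ⁻¹ (-1) = 1 := by rw [MulChar.inv_apply_eq_inv', heven, inv_one]
    rw [heven, one_mul] at hgg
    push_cast at h hgg ⊢
    rw [h, h1]
    have hpm' : (p : ℂ) ^ m ≠ 0 := by exact_mod_cast hpm
    field_simp
    linear_combination dampedTwist f (fun n ↦ χ n) Y * hgg
  rw [Finset.sum_congr rfl hterm, Finset.sum_sub_distrib]
  congr 1
  · rw [sum_mul_dampedTwist f (wildChars p m) (fun _ ↦ (1 : ℂ))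
      (fun (χ : DirichletCharacter ℂ (p ^ m)) (n : ℕ) ↦ χ n) (B := 1)
      (fun χ n ↦ DirichletCharacter.norm_le_one χ _) hY]
    simp
  · rw [← Finset.mul_sum, sum_mul_dampedTwist g (wildChars p m) _
      (fun (χ : DirichletCharacter ℂ (p ^ m)) (n : ℕ) ↦ χ⁻¹ n) (B := 1)
      (fun χ n ↦ DirichletCharacter.norm_le_one χ⁻¹ _) hY']

end MomentIdentity

/-! ### The two error terms -/

section Errors

open ModularForms UpperHalfPlane

variable {N : ℕ} [NeZero N] (f : CuspForm (CongruenceSubgroup.Gamma0 N) 2) {p : ℕ} [hp : Fact p.Prime]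

/-- **The sparse set of the main term**: if `n ≥ 2` and `n^{2(p-1)} ≡ 1 (mod q)`, then
`n ≥ q^{1/(2(p-1))}`. [folklore] -/
theorem rpow_le_of_pow_cast_eq_one {q : ℕ} (_hq : 0 < q) {n : ℕ} (hn : 2 ≤ n)
    (h : ((n : ℕ) : ZMod q) ^ (2 * (p - 1)) = 1) :
    (q : ℝ) ^ (1 / (2 * (p - 1) : ℝ)) ≤ n := by
  have hp2 := hp.out.two_le
  set d : ℕ := 2 * (p - 1) with hd
  have hd0 : 0 < d := by omega
  -- `q ≤ n^d` in `ℕ`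
  have hqn : q ≤ n ^ d := by
    have hdvd : (q : ℤ) ∣ (n : ℤ) ^ d - 1 := by
      rw [← ZMod.intCast_zmod_eq_zero_iff_dvd]; push_cast; rw [h, sub_self]
    have hpos : (0 : ℤ) < (n : ℤ) ^ d - 1 := by
      have : (2 : ℤ) ^ d ≤ (n : ℤ) ^ d := pow_le_pow_left₀ (by norm_num) (by exact_mod_cast hn) d
      have : (2 : ℤ) ≤ 2 ^ d := by
        calc (2 : ℤ) = 2 ^ 1 := by norm_num
          _ ≤ 2 ^ d := pow_le_pow_right₀ (by norm_num) hd0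
      linarith
    have := Int.le_of_dvd hpos hdvd
    have h' : (q : ℤ) ≤ (n : ℤ) ^ d := by linarith
    exact_mod_cast h'
  have hdr : (d : ℝ) = (2 * (p - 1) : ℝ) := by
    rw [hd]; push_cast [Nat.cast_sub (by omega : 1 ≤ p)]; ring
  calc (q : ℝ) ^ (1 / (2 * (p - 1) : ℝ)) ≤ ((n : ℝ) ^ d) ^ (1 / (2 * (p - 1) : ℝ)) := by
        refine Real.rpow_le_rpow (Nat.cast_nonneg _) (by exact_mod_cast hqn) ?_
        rw [← hdr]; positivity
    _ = n := by
        rw [← hdr, ← Real.rpow_natCast, ← Real.rpow_mul (Nat.cast_nonneg _), one_div,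
          mul_inv_cancel₀ (by exact_mod_cast hd0.ne'), Real.rpow_one]

omit [NeZero N] in
/-- **The main-term error.** For `f` with `a₁ = 1`, `|aₙ| ≤ C n^θ` (`0 < θ ≤ 1`), `m ≥ 1` and
`Y > 0`, with `q = p^{m-1}`:
`‖D_f(A, Y) - #𝔛_m e^{-2πY}‖ ≤ #𝔛_m · C · 4p · (q^{(θ-1)/(2(p-1))} + q^{θ-1}(1 + Γ(θ)(2πYq)^{-θ}))`,
`A = ∑_{χ ∈ 𝔛_m} χ`: the terms `n ≥ 2` with `A(n) ≠ 0` have `n^{2(p-1)} ≡ 1 (mod q)`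
(`pow_eq_one_of_sum_wildChars_ne_zero`), and `sum_range_indicator_rpow_mul_exp_le` applies with
at most `4p` classes (`card_filter_pow_eq_one_le`). [folklore] -/
theorem norm_dampedTwist_sum_wildChars_sub_le {m : ℕ} [NeZero (p ^ m)] (hm : m ≠ 0) {C θ : ℝ}
    (hC : 0 ≤ C) (hθ : 0 < θ) (hθ1 : θ ≤ 1) (ha : ∀ n : ℕ, ‖cuspCoeff f n‖ ≤ C * (n : ℝ) ^ θ)
    (h1 : cuspCoeff f 1 = 1) {Y : ℝ} (hY : 0 < Y) :
    ‖dampedTwist f (fun n ↦ ∑ χ ∈ wildChars p m, χ n) Y -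
        (wildChars p m).card * (Real.exp (-(2 * Real.pi) * Y) : ℝ)‖ ≤
      (wildChars p m).card * (C * ((4 * p : ℕ) *
        ((((p ^ (m - 1) : ℕ) : ℝ) ^ (1 / (2 * (p - 1) : ℝ))) ^ (θ - 1) +
          ((p ^ (m - 1) : ℕ) : ℝ) ^ (θ - 1) *
            (1 + Real.Gamma θ * (2 * Real.pi * Y * (p ^ (m - 1) : ℕ)) ^ (-θ))))) := by
  classical
  set q : ℕ := p ^ (m - 1) with hq
  have hq0 : 0 < q := pow_pos hp.out.pos _
  haveI : NeZero q := ⟨hq0.ne'⟩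
  set X := wildChars p m with hX
  set A : ℕ → ℂ := fun n ↦ ∑ χ ∈ X, χ n with hA
  set c : ℝ := 2 * Real.pi * Y with hc
  have hcpos : 0 < c := by positivity
  set term : ℕ → ℂ := fun n ↦ A n * cuspCoeff f n * (Real.exp (-(2 * Real.pi * n) * Y) / n : ℝ)
    with hterm
  have hAle : ∀ n : ℕ, ‖A n‖ ≤ X.card := fun n ↦ norm_sum_wildChars_apply_le _
  have hsum : Summable term := summable_dampedTwist f hAle hY
  -- the term `n = 1`
  have hA1 : A 1 = X.card := by simp [hA]
  have ht1 : term 1 = X.card * (Real.exp (-(2 * Real.pi) * Y) : ℝ) := by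
    simp only [hterm, hA1, h1, Nat.cast_one, mul_one, div_one]
  have hsplit : dampedTwist f (fun n ↦ ∑ χ ∈ X, χ n) Y -
      X.card * (Real.exp (-(2 * Real.pi) * Y) : ℝ) = ∑' n : ℕ, if n = 1 then 0 else term n := by
    rw [dampedTwist, show (fun n : ℕ ↦ (∑ χ ∈ X, χ (n : ZMod (p ^ m))) * cuspCoeff f n *
      (Real.exp (-(2 * Real.pi * n) * Y) / n : ℝ)) = term from rfl, hsum.tsum_eq_add_tsum_ite 1, ht1]
    ring
  -- the majorant
  set S : ℕ → Prop := fun n ↦ ((n : ℕ) : ZMod q) ^ (2 * (p - 1)) = 1 with hS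
  set g : ℕ → ℝ := fun n ↦ X.card * (C *
    (if S n ∧ 2 ≤ n then (n : ℝ) ^ (θ - 1) * Real.exp (-c * n) else 0)) with hg
  have hg0 : ∀ n, 0 ≤ g n := fun n ↦ by
    simp only [hg]; split_ifs <;> positivity
  have hg_le : ∀ n, g n ≤ X.card * (C * ((n : ℝ) ^ (θ - 1) * Real.exp (-c * n))) := fun n ↦ by
    simp only [hg]
    split_ifs
    · exact le_rfl
    · rw [mul_zero, mul_zero]; positivity
  have hg_summable : Summable g :=
    Summable.of_nonneg_of_le hg0 hg_le (((summable_rpow_mul_exp hθ1 hcpos).mul_left C).mul_left _)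
  -- pointwise comparison
  have hpt : ∀ n : ℕ, ‖(if n = 1 then (0 : ℂ) else term n)‖ ≤ g n := by
    intro n
    by_cases hn1 : n = 1
    · rw [if_pos hn1, norm_zero]; exact hg0 n
    rw [if_neg hn1]
    rcases Nat.eq_zero_or_pos n with rfl | hnpos
    · simp only [hterm, Nat.cast_zero, div_zero, Complex.ofReal_zero, mul_zero, norm_zero]
      exact hg0 0
    have hn2 : 2 ≤ n := by omega
    by_cases hAn : A n = 0
    · simp only [hterm, hAn, zero_mul, norm_zero]; exact hg0 n
    have hSn : S n := by
      have := pow_eq_one_of_sum_wildChars_ne_zero (p := p) hm (n := n) hAn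
      simpa [hS, hq] using this
    have hgn : g n = X.card * (C * ((n : ℝ) ^ (θ - 1) * Real.exp (-c * n))) := by
      simp only [hg, if_pos (And.intro hSn hn2)]
    rw [hgn, hterm]
    dsimp only
    rw [norm_mul, norm_mul, Complex.norm_real, Real.norm_of_nonneg (by positivity)]
    have hnr : (0 : ℝ) < n := Nat.cast_pos.mpr hnpos
    calc ‖A n‖ * ‖cuspCoeff f n‖ * (Real.exp (-(2 * Real.pi * n) * Y) / n)
        ≤ X.card * (C * (n : ℝ) ^ θ) * (Real.exp (-(2 * Real.pi * n) * Y) / n) := by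
          gcongr
          · exact hAle n
          · exact ha n
      _ = X.card * (C * ((n : ℝ) ^ (θ - 1) * Real.exp (-c * n))) := by
          rw [Real.rpow_sub_one hnr.ne', hc]
          field_simp
  -- partial sums of the majorant
  have hR := card_filter_pow_eq_one_le (p := p) (m - 1)
  set n₀ : ℝ := ((q : ℕ) : ℝ) ^ (1 / (2 * (p - 1) : ℝ)) with hn₀def
  have hn₀ : 0 < n₀ := by positivity
  have hE0 : 0 ≤ n₀ ^ (θ - 1) + ((q : ℕ) : ℝ) ^ (θ - 1) * (1 + Real.Gamma θ * (c * q) ^ (-θ)) := by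
    have := Real.Gamma_pos_of_pos hθ; positivity
  have hpartial : ∀ M : ℕ, ∑ n ∈ Finset.range M, g n ≤ X.card * (C * ((4 * p : ℕ) *
      (n₀ ^ (θ - 1) + ((q : ℕ) : ℝ) ^ (θ - 1) * (1 + Real.Gamma θ * (c * q) ^ (-θ))))) := by
    intro M
    simp only [hg, ← Finset.mul_sum]
    refine mul_le_mul_of_nonneg_left (mul_le_mul_of_nonneg_left ?_ hC) (Nat.cast_nonneg _)
    have h := sum_range_indicator_rpow_mul_exp_le hθ hθ1 hcpos hq0
      (Finset.univ.filter fun r : ZMod q ↦ r ^ (2 * (p - 1)) = 1) hn₀ S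
      (fun n hn ↦ by simpa [hS] using hn) (fun n hn hn2 ↦ rpow_le_of_pow_cast_eq_one hq0 hn2 hn) M
    refine h.trans ?_
    have hR' : (((Finset.univ.filter fun r : ZMod q ↦ r ^ (2 * (p - 1)) = 1).card : ℕ) : ℝ) ≤
        ((4 * p : ℕ) : ℝ) := by exact_mod_cast hR
    exact mul_le_mul_of_nonneg_right hR' hE0
  -- conclusion
  rw [hsplit]
  refine (tsum_of_norm_bounded hg_summable.hasSum hpt).trans ?_
  refine (Real.tsum_le_of_sum_range_le hg0 hpartial).trans (le_of_eq ?_)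
  rw [hn₀def, hc]

omit hp in
/-- `χ(N) τ(χ)² χ̄(n) = χ(N n̄⁻¹) τ(χ)²` for a unit `n̄ = n mod p^m`. [folklore] -/
theorem mul_inv_apply_eq {m : ℕ} [NeZero (p ^ m)] (χ : DirichletCharacter ℂ (p ^ m)) (a : ZMod (p ^ m))
    {x : ZMod (p ^ m)} (hx : IsUnit x) : χ a * χ⁻¹ x = χ (a * x⁻¹) := by
  rw [map_mul, MulChar.inv_apply, ← hx.unit_spec, Ring.inverse_unit, ZMod.inv_coe_unit]

omit [NeZero N] in
/-- **The dual-term error.** For a cusp form `f ∈ S_2(Γ₀(N))` (applied below to the dual form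
`g = w_N f` of a Fricke pair) with `|aₙ| ≤ C n^θ` (`0 < θ ≤ 1`; Hecke's bound `θ = 1` is
allowed), `p ∤ N`, `m ≥ 1`, `Y' > 0`:
`‖D_f(B, Y')‖ ≤ #𝔛_m · C · (4p² · 4p^{⌈m/2⌉}) · (1 + Γ(θ)(2πY')^{-θ})`, where
`B(n) = ∑_{χ ∈ 𝔛_m} χ(N) τ(χ)² χ̄(n)` is bounded by the Kloosterman estimate
`norm_sum_wildChars_mul_gaussSum_sq_le`. [folklore] -/
theorem norm_dampedTwist_dual_le {m : ℕ} [NeZero (p ^ m)] (hm : m ≠ 0) (hpN : ¬ p ∣ N) {C θ : ℝ}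
    (hC : 0 ≤ C) (hθ : 0 < θ) (hθ1 : θ ≤ 1) (ha : ∀ n : ℕ, ‖cuspCoeff f n‖ ≤ C * (n : ℝ) ^ θ)
    {Y' : ℝ} (hY' : 0 < Y') :
    ‖dampedTwist f (fun n ↦ ∑ χ ∈ wildChars p m,
        χ N * gaussSum χ (ZMod.stdAddChar (N := p ^ m)) ^ 2 * χ⁻¹ n) Y'‖ ≤
      (wildChars p m).card * (C * (((4 * p * p : ℕ) * (4 * (p : ℝ) ^ (m - m / 2))) *
        (1 + Real.Gamma θ * (2 * Real.pi * Y') ^ (-θ)))) := by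
  classical
  set X := wildChars p m with hX
  set β : ℝ := (4 * p * p : ℕ) * (4 * (p : ℝ) ^ (m - m / 2)) with hβ
  have hβ0 : 0 ≤ β := by positivity
  set Bw : ℕ → ℂ := fun n ↦ ∑ χ ∈ X, χ N * gaussSum χ (ZMod.stdAddChar (N := p ^ m)) ^ 2 * χ⁻¹ n
    with hBw
  set c : ℝ := 2 * Real.pi * Y' with hc
  have hcpos : 0 < c := by positivity
  have hNu : IsUnit ((N : ℕ) : ZMod (p ^ m)) := by
    rw [ZMod.isUnit_iff_coprime]
    exact ((Nat.Prime.coprime_iff_not_dvd hp.out).mpr hpN).symm.pow_right m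
  -- bound for the weight
  have hBle : ∀ n : ℕ, ‖Bw n‖ ≤ X.card * β := by
    intro n
    by_cases hn : IsUnit ((n : ℕ) : ZMod (p ^ m))
    · have : Bw n = ∑ χ ∈ X, χ ((N : ZMod (p ^ m)) * ((n : ℕ) : ZMod (p ^ m))⁻¹) *
          gaussSum χ (ZMod.stdAddChar (N := p ^ m)) ^ 2 := by
        refine Finset.sum_congr rfl fun χ _ ↦ ?_
        rw [← mul_inv_apply_eq χ _ hn]; ring
      rw [this]
      have hyu : IsUnit ((N : ZMod (p ^ m)) * ((n : ℕ) : ZMod (p ^ m))⁻¹) := by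
        refine hNu.mul ?_
        rw [← hn.unit_spec, ZMod.inv_coe_unit]; exact Units.isUnit _
      have h := norm_sum_wildChars_mul_gaussSum_sq_le hm hyu
      rw [hβ, hX]
      refine h.trans (le_of_eq ?_)
      push_cast; ring
    · have : Bw n = 0 := Finset.sum_eq_zero fun χ _ ↦ by rw [MulChar.map_nonunit χ⁻¹ hn, mul_zero]
      rw [this, norm_zero]; positivity
  -- the majorant (zero at `n = 0`, where the term vanishes)
  set h : ℕ → ℝ := fun n ↦
    if n = 0 then 0 else X.card * β * C * ((n : ℝ) ^ (θ - 1) * Real.exp (-c * n)) with hh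
  have hh0 : ∀ n, 0 ≤ h n := fun n ↦ by
    simp only [hh]; split_ifs <;> positivity
  have hh_le : ∀ n, h n ≤ X.card * β * C * ((n : ℝ) ^ (θ - 1) * Real.exp (-c * n)) := fun n ↦ by
    simp only [hh]; split_ifs <;> first | positivity | exact le_rfl
  have hh_summable : Summable h :=
    Summable.of_nonneg_of_le hh0 hh_le ((summable_rpow_mul_exp hθ1 hcpos).mul_left _)
  have hpt : ∀ n : ℕ, ‖Bw n * cuspCoeff f n * (Real.exp (-(2 * Real.pi * n) * Y') / n : ℝ)‖ ≤ h n := by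
    intro n
    rcases Nat.eq_zero_or_pos n with rfl | hnpos
    · simp only [Nat.cast_zero, div_zero, Complex.ofReal_zero, mul_zero, norm_zero]; exact hh0 0
    have hnr : (0 : ℝ) < n := Nat.cast_pos.mpr hnpos
    rw [norm_mul, norm_mul, Complex.norm_real, Real.norm_of_nonneg (by positivity), hh]
    dsimp only
    rw [if_neg hnpos.ne']
    calc ‖Bw n‖ * ‖cuspCoeff f n‖ * (Real.exp (-(2 * Real.pi * n) * Y') / n)
        ≤ (X.card * β) * (C * (n : ℝ) ^ θ) * (Real.exp (-(2 * Real.pi * n) * Y') / n) := by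
          gcongr
          · exact hBle n
          · exact ha n
      _ = X.card * β * C * ((n : ℝ) ^ (θ - 1) * Real.exp (-c * n)) := by
          rw [Real.rpow_sub_one hnr.ne', hc]
          field_simp
  -- `∑ h ≤ #X β C (1 + Γ c^{-θ})`
  have htsum : ∑' n, h n ≤ X.card * β * C * (1 + Real.Gamma θ * c ^ (-θ)) := by
    have h0 : h 0 = 0 := by simp only [hh, if_pos rfl]
    rw [hh_summable.tsum_eq_zero_add, h0, zero_add]
    have h' : ∀ n : ℕ, h (n + 1) = X.card * β * C *
        ((((n + 1 : ℕ) : ℝ)) ^ (θ - 1) * Real.exp (-c * ((n + 1 : ℕ) : ℝ))) := fun n ↦ by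
      simp only [hh, if_neg (Nat.succ_ne_zero n)]
    simp only [h']
    rw [tsum_mul_left]
    refine mul_le_mul_of_nonneg_left ?_ (by positivity)
    refine Real.tsum_le_of_sum_range_le (fun n ↦ by positivity) fun M ↦ ?_
    exact sum_range_rpow_mul_exp_le hθ hθ1 hcpos M
  rw [dampedTwist]
  refine (tsum_of_norm_bounded hh_summable.hasSum hpt).trans (htsum.trans (le_of_eq ?_))
  rw [hβ, hc]; ring

end Errors

/-! ### Asymptotics and the non-vanishing of the first moment -/

section Final

open ModularForms UpperHalfPlane

/-- Exponent algebra for the main error term: with `X = p q`, `Y = X^{-a}`,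
`q^{θ-1} (2π X^{-a} q)^{-θ} = (2π)^{-θ} p^{aθ} q^{aθ - 1}`. [folklore] -/
private theorem main_exponent_eq {p q θ a : ℝ} (hp : 0 < p) (hq : 0 < q) :
    q ^ (θ - 1) * (2 * Real.pi * (p * q) ^ (-a) * q) ^ (-θ) =
      (2 * Real.pi) ^ (-θ) * p ^ (a * θ) * q ^ (a * θ - 1) := by
  have h2π : (0 : ℝ) < 2 * Real.pi := Real.two_pi_pos
  have hpq : 0 < p * q := mul_pos hp hq
  rw [Real.mul_rpow (by positivity) hq.le, Real.mul_rpow h2π.le (by positivity),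
    ← Real.rpow_mul hpq.le, Real.mul_rpow hp.le hq.le,
    show -a * -θ = a * θ by ring]
  have : q ^ (θ - 1) * q ^ (a * θ) * q ^ (-θ) = q ^ (a * θ - 1) := by
    rw [← Real.rpow_add hq, ← Real.rpow_add hq]; ring_nf
  calc q ^ (θ - 1) * ((2 * Real.pi) ^ (-θ) * (p ^ (a * θ) * q ^ (a * θ)) * q ^ (-θ))
      = (2 * Real.pi) ^ (-θ) * p ^ (a * θ) * (q ^ (θ - 1) * q ^ (a * θ) * q ^ (-θ)) := by ring
    _ = _ := by rw [this]

/-- Exponent algebra for the dual error term: with `Y = X^{-a}`, `Y' = 1/(N X² Y)`,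
`(2π Y')^{-θ} = (2π/N)^{-θ} X^{(2-a)θ}`. [folklore] -/
private theorem dual_exponent_eq {N X θ a : ℝ} (hN : 0 < N) (hX : 0 < X) :
    (2 * Real.pi * (1 / (N * X ^ 2 * X ^ (-a)))) ^ (-θ) =
      (2 * Real.pi / N) ^ (-θ) * X ^ ((2 - a) * θ) := by
  have h2π : (0 : ℝ) < 2 * Real.pi := Real.two_pi_pos
  have hX2 : X ^ 2 * X ^ (-a) = X ^ (2 - a : ℝ) := by
    rw [show X ^ 2 = X ^ (2 : ℝ) by norm_cast, ← Real.rpow_add hX, sub_eq_add_neg]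
  rw [mul_assoc N, hX2, show 2 * Real.pi * (1 / (N * X ^ (2 - a : ℝ))) =
    (2 * Real.pi / N) * (X ^ (2 - a : ℝ))⁻¹ by field_simp, Real.mul_rpow (by positivity)
    (by positivity), Real.inv_rpow (by positivity), ← Real.rpow_mul hX.le, ← Real.rpow_neg
    (by positivity)]
  congr 2
  ring

/-- `p^{⌈m/2⌉} ≤ p · (p^m)^{1/2}`. [folklore] -/
private theorem pow_ceil_half_le {p : ℝ} (hp : 1 ≤ p) (m : ℕ) :
    p ^ (m - m / 2) ≤ p * (p ^ m) ^ (1 / 2 : ℝ) := by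
  have hp0 : 0 ≤ p := by linarith
  have h2 : ((m - m / 2 : ℕ) : ℝ) ≤ 1 + m * (1 / 2 : ℝ) := by
    have : 2 * (m - m / 2) ≤ m + 2 := by omega
    have h' : ((2 * (m - m / 2) : ℕ) : ℝ) ≤ ((m + 2 : ℕ) : ℝ) := by exact_mod_cast this
    push_cast at h'
    linarith
  calc p ^ (m - m / 2) = p ^ ((m - m / 2 : ℕ) : ℝ) := (Real.rpow_natCast p _).symm
    _ ≤ p ^ (1 + m * (1 / 2 : ℝ)) := Real.rpow_le_rpow_of_exponent_le hp h2
    _ = p * (p ^ m) ^ (1 / 2 : ℝ) := by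
        rw [Real.rpow_add' hp0 (by positivity), Real.rpow_one, Real.rpow_natCast_mul hp0]

variable {N : ℕ} [NeZero N] (f : CuspForm (CongruenceSubgroup.Gamma0 N) 2) {p : ℕ} [hp : Fact p.Prime]

/-- `𝔛_m` is non-empty for `m ≥ 3` (a primitive even character of `p`-power order exists,
`exists_isPrimitive_even_orderOf_eq_prime_pow`). [folklore] -/
theorem wildChars_nonempty (k : ℕ) : (wildChars p (k + 3)).Nonempty := by
  haveI : NeZero ((Nat.totient (p ^ (k + 3)) : ℕ) : ℂ) :=
    ⟨Nat.cast_ne_zero.mpr (Nat.totient_pos.mpr (pow_pos hp.out.pos _)).ne'⟩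
  obtain ⟨ψ, h1, h2, h3⟩ := exists_isPrimitive_even_orderOf_eq_prime_pow ℂ (p := p) k
  exact ⟨ψ, (mem_wildChars ψ).mpr ⟨h1, h2, h3⟩⟩

/-- **Non-vanishing of the first moment** (the replacement of Rohrlich's theorem for the `p`-adic
`L`-function). Let `f, g ∈ S_2(Γ₀(N))` form a Fricke pair, `f(-1/(Nτ)) = N τ² g(τ)` (e.g.
`g = w_N f`; no eigen-assumption), with `a₁(f) = 1`, `|aₙ(f)| ≤ C n^θ` for some `θ < 2/3` and
`|bₙ(g)| ≤ C' n^{θ'}` for some `θ' ≤ 1` (Hecke's trivial bound), and let `p ∤ N`. Then for all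
large `m` some wild character `χ` of conductor `p^m` (primitive, even, of `p`-power order) has
`∑_a χ(a) {∞, a/p^m}_f ≠ 0`, i.e. `L(f, χ̄, 1) ≠ 0` by Birch's formula. Proof: with `Y = p^{-am}`
for an exponent `3/2 < a < 1/θ`, the weighted first moment
`∑_{χ ∈ 𝔛_m} (τ(χ)/p^m) ∑_a χ̄(a){∞, a/p^m}` equals `#𝔛_m e^{-2πY} + O(#𝔛_m δ_m)` with
`δ_m = O(p^{m(aθ-1)} + p^{m((2-a)θ' - 1/2)} + …) → 0` (`sum_wildChars_twistedSymbolSum_eq`,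
`norm_dampedTwist_sum_wildChars_sub_le`, `norm_dampedTwist_dual_le`), so it cannot vanish
(after Rohrlich 1984, whose Theorem gives `L(f, χ, 1) ≠ 0` for all but finitely many `χ` of
`p`-power conductor via the Galois average and Shimura's algebraicity; the family average used
here needs neither, nor the `w_N`-eigen-property of `f`). [folklore] -/
theorem exists_wildChars_twistedSymbolSum_ne_zero {g : CuspForm (CongruenceSubgroup.Gamma0 N) 2}
    (hW : IsFrickePair N f g) (hpN : ¬ p ∣ N) {C θ C' θ' : ℝ} (hC : 0 ≤ C) (hθ : 0 < θ)
    (hθ1 : θ < 2 / 3) (hC' : 0 ≤ C') (hθ' : 0 < θ') (hθ'1 : θ' ≤ 1)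
    (ha : ∀ n : ℕ, ‖cuspCoeff f n‖ ≤ C * (n : ℝ) ^ θ)
    (hb : ∀ n : ℕ, ‖cuspCoeff g n‖ ≤ C' * (n : ℝ) ^ θ') (h1 : cuspCoeff f 1 = 1) :
    ∃ m₀ : ℕ, ∀ m : ℕ, m₀ ≤ m → ∃ χ ∈ wildChars p m, twistedSymbolSum f χ ≠ 0 := by
  have hpr : (1 : ℝ) < p := by exact_mod_cast hp.out.one_lt
  have hp0 : (0 : ℝ) < p := by linarith
  have hNr : (0 : ℝ) < N := Nat.cast_pos.mpr (NeZero.pos N)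
  have h2π : (0 : ℝ) < 2 * Real.pi := Real.two_pi_pos
  -- the exponent `a`, `3/2 < a < 1/θ`
  set a : ℝ := 3 / 4 + 1 / (2 * θ) with hadef
  have haθ' : a * θ = 3 / 4 * θ + 1 / 2 := by
    rw [hadef]; field_simp
  have haθ : a * θ - 1 < 0 := by rw [haθ']; linarith
  have ha32 : 3 / 2 < a := by
    have : 3 / 4 < 1 / (2 * θ) := by
      rw [lt_div_iff₀ (by positivity)]; linarith
    rw [hadef]; linarith
  have ha0 : 0 < a := by linarith
  have hdual : (2 - a) * θ' - 1 / 2 < 0 := by nlinarith [mul_pos (sub_pos.mpr ha32) hθ', hθ'1]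
  -- the parameters as functions of `m`
  set X : ℕ → ℝ := fun m ↦ (p : ℝ) ^ m with hXdef
  set q : ℕ → ℝ := fun m ↦ (p : ℝ) ^ (m - 1) with hqdef
  set Y : ℕ → ℝ := fun m ↦ X m ^ (-a) with hYdef
  have hXpos : ∀ m, 0 < X m := fun m ↦ pow_pos hp0 m
  have hqpos : ∀ m, 0 < q m := fun m ↦ pow_pos hp0 _
  have hYpos : ∀ m, 0 < Y m := fun m ↦ Real.rpow_pos_of_pos (hXpos m) _
  have hXq : ∀ m, m ≠ 0 → X m = p * q m := fun m hm ↦ by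
    simp only [hXdef, hqdef]
    rw [← pow_succ', Nat.sub_add_cancel (Nat.pos_of_ne_zero hm)]
  -- the error sequences
  set e₁ : ℝ := (θ - 1) / (2 * (p - 1) : ℝ) with he₁
  set K₃ : ℝ := Real.Gamma θ * ((2 * Real.pi) ^ (-θ) * (p : ℝ) ^ (a * θ)) with hK₃
  set err₁ : ℕ → ℝ := fun m ↦ C * ((4 * p : ℕ) *
    (q m ^ e₁ + (q m ^ (θ - 1) + K₃ * q m ^ (a * θ - 1)))) with herr₁
  set K₄ : ℝ := C' * ((4 * p * p : ℕ) * (4 * (p : ℝ))) with hK₄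
  set K₅ : ℝ := Real.Gamma θ' * (2 * Real.pi / N) ^ (-θ') with hK₅
  set err₂ : ℕ → ℝ := fun m ↦ K₄ * (X m ^ (-(1 / 2 : ℝ)) + K₅ * X m ^ ((2 - a) * θ' - 1 / 2))
    with herr₂
  -- limits
  have hXlim : Tendsto X atTop atTop := tendsto_pow_atTop_atTop_of_one_lt hpr
  have hqlim : Tendsto q atTop atTop :=
    (tendsto_pow_atTop_atTop_of_one_lt hpr).comp (tendsto_sub_atTop_nat 1)
  have hrpow : ∀ {Z : ℕ → ℝ} (_ : Tendsto Z atTop atTop) {e : ℝ} (_ : e < 0),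
      Tendsto (fun m ↦ Z m ^ e) atTop (𝓝 0) := by
    intro Z hZ e he
    have h := (tendsto_rpow_neg_atTop (neg_pos.mpr he)).comp hZ
    simp only [neg_neg] at h
    exact h
  have hp1r : (1 : ℝ) ≤ (p : ℝ) - 1 := by
    have : (2 : ℝ) ≤ p := by exact_mod_cast hp.out.two_le
    linarith
  have he₁neg : e₁ < 0 := div_neg_of_neg_of_pos (by linarith) (by positivity)
  have herr₁lim : Tendsto err₁ atTop (𝓝 0) := by
    have h := ((hrpow hqlim he₁neg).add ((hrpow hqlim (by linarith : θ - 1 < 0)).add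
      ((hrpow hqlim haθ).const_mul K₃))).const_mul ((4 * p : ℕ) : ℝ)
      |>.const_mul C
    simpa [herr₁] using h
  have herr₂lim : Tendsto err₂ atTop (𝓝 0) := by
    have h := ((hrpow hXlim (by norm_num : -(1 / 2 : ℝ) < 0)).add
      ((hrpow hXlim hdual).const_mul K₅)).const_mul K₄
    simpa [herr₂] using h
  have hexplim : Tendsto (fun m ↦ Real.exp (-(2 * Real.pi) * Y m)) atTop (𝓝 1) := by
    have hY0 : Tendsto Y atTop (𝓝 0) := hrpow hXlim (by linarith : -a < 0)
    have h0 : Tendsto (fun m ↦ -(2 * Real.pi) * Y m) atTop (𝓝 0) := by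
      simpa using hY0.const_mul (-(2 * Real.pi))
    have := (Real.continuous_exp.tendsto 0).comp h0
    rw [Real.exp_zero] at this
    refine this.congr fun m ↦ ?_
    simp only [Function.comp_apply]
  -- choose `m₀`
  have hev : ∀ᶠ m in atTop, err₁ m + err₂ m < 1 / 2 ∧ 1 / 2 < Real.exp (-(2 * Real.pi) * Y m) ∧ 3 ≤ m := by
    refine ((herr₁lim.add herr₂lim).eventually (gt_mem_nhds ?_)).and
      ((hexplim.eventually (lt_mem_nhds ?_)).and (eventually_ge_atTop 3))
    · norm_num
    · norm_num
  obtain ⟨m₀, hm₀⟩ := eventually_atTop.mp hev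
  refine ⟨m₀, fun m hm ↦ ?_⟩
  obtain ⟨hlt, hexp, hm3⟩ := hm₀ m hm
  -- suppose all the twisted symbol sums vanish
  by_contra hall
  push Not at hall
  have hm0 : m ≠ 0 := by omega
  obtain ⟨k, rfl⟩ : ∃ k, m = k + 3 := ⟨m - 3, by omega⟩
  set M := k + 3 with hM
  have hcard : 0 < ((wildChars p M).card : ℝ) := by
    exact_mod_cast Finset.card_pos.mpr (wildChars_nonempty k)
  -- the moment vanishes
  have hmom : ∑ χ ∈ wildChars p M, gaussSum χ (ZMod.stdAddChar (N := p ^ M)) / (p ^ M : ℂ) *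
      twistedSymbolSum f χ⁻¹ = 0 :=
    Finset.sum_eq_zero fun χ hχ ↦ by rw [hall χ⁻¹ (inv_mem_wildChars hχ), mul_zero]
  rw [sum_wildChars_twistedSymbolSum_eq f hW hpN (hYpos M)] at hmom
  -- the two error bounds at `Y = Y M`
  have hE₁ := norm_dampedTwist_sum_wildChars_sub_le f (p := p) hm0 hC hθ (by linarith) ha h1 (hYpos M)
  have hY'pos : 0 < 1 / ((N : ℝ) * (p ^ M : ℕ) ^ 2 * Y M) := by
    have : (0 : ℝ) < (p ^ M : ℕ) := Nat.cast_pos.mpr (pow_pos hp.out.pos _)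
    have := hYpos M
    positivity
  have hE₂ := norm_dampedTwist_dual_le g (p := p) hm0 hpN hC' hθ' hθ'1 hb hY'pos
  -- simplify the error bounds to `#𝔛 · err₁ M` and `#𝔛 · err₂ M`
  have hqM : ((p ^ (M - 1) : ℕ) : ℝ) = q M := by simp [hqdef]
  have hXM : ((p ^ M : ℕ) : ℝ) = X M := by simp [hXdef]
  have hA : (q M ^ (1 / (2 * (p - 1) : ℝ))) ^ (θ - 1) = q M ^ e₁ := by
    rw [← Real.rpow_mul (hqpos M).le, he₁]
    congr 1
    have : (2 * (p - 1) : ℝ) ≠ 0 := by positivity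
    field_simp
  have hB : q M ^ (θ - 1) * (1 + Real.Gamma θ * (2 * Real.pi * Y M * q M) ^ (-θ)) =
      q M ^ (θ - 1) + K₃ * q M ^ (a * θ - 1) := by
    rw [hYdef]
    dsimp only
    rw [hXq M hm0, hK₃]
    have h := main_exponent_eq (θ := θ) (a := a) hp0 (hqpos M)
    linear_combination Real.Gamma θ * h
  have hE₁' : ‖dampedTwist f (fun n ↦ ∑ χ ∈ wildChars p M, χ n) (Y M) -
      (wildChars p M).card * (Real.exp (-(2 * Real.pi) * Y M) : ℝ)‖ ≤ (wildChars p M).card * err₁ M := by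
    have h := hE₁
    rw [hqM, hA, hB] at h
    simpa only [herr₁] using h
  have hE₂' : ‖(1 / (p ^ M : ℂ)) * dampedTwist g (fun n ↦ ∑ χ ∈ wildChars p M,
      χ N * gaussSum χ (ZMod.stdAddChar (N := p ^ M)) ^ 2 * χ⁻¹ n) (1 / ((N : ℝ) * (p ^ M : ℕ) ^ 2 * Y M))‖ ≤
      (wildChars p M).card * err₂ M := by
    rw [norm_mul, norm_div, norm_one, show ‖(p ^ M : ℂ)‖ = X M by
      rw [show (p ^ M : ℂ) = ((p ^ M : ℕ) : ℂ) by push_cast; rfl, Complex.norm_natCast, hXM]]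
    refine (mul_le_mul_of_nonneg_left hE₂ (by positivity)).trans ?_
    rw [hXM]
    have hZ : (2 * Real.pi * (1 / ((N : ℝ) * X M ^ 2 * Y M))) ^ (-θ') =
        (2 * Real.pi / N) ^ (-θ') * X M ^ ((2 - a) * θ') := by
      rw [hYdef]; exact dual_exponent_eq hNr (hXpos M)
    have hpk : (p : ℝ) ^ (M - M / 2) ≤ p * X M ^ (1 / 2 : ℝ) := pow_ceil_half_le hpr.le M
    have hG : 0 ≤ Real.Gamma θ' := (Real.Gamma_pos_of_pos hθ').le
    have hx1 : X M ^ (1 / 2 : ℝ) / X M = X M ^ (-(1 / 2 : ℝ)) := by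
      rw [div_eq_iff (hXpos M).ne', ← Real.rpow_add_one (hXpos M).ne']
      norm_num
    have hx2 : X M ^ (1 / 2 : ℝ) * X M ^ ((2 - a) * θ') / X M = X M ^ ((2 - a) * θ' - 1 / 2) := by
      rw [div_eq_iff (hXpos M).ne', ← Real.rpow_add (hXpos M), ← Real.rpow_add_one (hXpos M).ne']
      congr 1; ring
    rw [hZ]
    calc 1 / X M * ((wildChars p M).card * (C' * (((4 * p * p : ℕ) * (4 * (p : ℝ) ^ (M - M / 2))) *
          (1 + Real.Gamma θ' * ((2 * Real.pi / N) ^ (-θ') * X M ^ ((2 - a) * θ'))))))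
        ≤ 1 / X M * ((wildChars p M).card * (C' * (((4 * p * p : ℕ) * (4 * ((p : ℝ) * X M ^ (1 / 2 : ℝ)))) *
          (1 + Real.Gamma θ' * ((2 * Real.pi / N) ^ (-θ') * X M ^ ((2 - a) * θ')))))) := by
          gcongr
      _ = (wildChars p M).card * (C' * ((4 * p * p : ℕ) * (4 * (p : ℝ)))) *
          (X M ^ (1 / 2 : ℝ) / X M + Real.Gamma θ' * (2 * Real.pi / N) ^ (-θ') *
            (X M ^ (1 / 2 : ℝ) * X M ^ ((2 - a) * θ') / X M)) := by
          ring
      _ = (wildChars p M).card * err₂ M := by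
          rw [hx1, hx2]
          simp only [herr₂, hK₄, hK₅]
          ring
  -- the contradiction
  have hkey : ((wildChars p M).card : ℝ) * Real.exp (-(2 * Real.pi) * Y M) ≤
      (wildChars p M).card * err₁ M + (wildChars p M).card * err₂ M := by
    have hnorm : ‖((wildChars p M).card * (Real.exp (-(2 * Real.pi) * Y M) : ℝ) : ℂ)‖ =
        ((wildChars p M).card : ℝ) * Real.exp (-(2 * Real.pi) * Y M) := by
      rw [show ((wildChars p M).card * (Real.exp (-(2 * Real.pi) * Y M) : ℝ) : ℂ) =
        (((wildChars p M).card * Real.exp (-(2 * Real.pi) * Y M) : ℝ) : ℂ) by push_cast; ring,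
        Complex.norm_real, Real.norm_of_nonneg (by positivity)]
    rw [← hnorm]
    set D₁ := dampedTwist f (fun n ↦ ∑ χ ∈ wildChars p M, χ n) (Y M)
    set D₂ := (1 / (p ^ M : ℂ)) * dampedTwist g (fun n ↦ ∑ χ ∈ wildChars p M,
      χ N * gaussSum χ (ZMod.stdAddChar (N := p ^ M)) ^ 2 * χ⁻¹ n) (1 / ((N : ℝ) * (p ^ M : ℕ) ^ 2 * Y M))
    have hD : D₁ = D₂ := sub_eq_zero.mp hmom
    calc ‖((wildChars p M).card * (Real.exp (-(2 * Real.pi) * Y M) : ℝ) : ℂ)‖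
        = ‖(((wildChars p M).card * (Real.exp (-(2 * Real.pi) * Y M) : ℝ) : ℂ) - D₁) + D₂‖ := by
          rw [hD, sub_add_cancel]
      _ ≤ ‖((wildChars p M).card * (Real.exp (-(2 * Real.pi) * Y M) : ℝ) : ℂ) - D₁‖ + ‖D₂‖ :=
          norm_add_le _ _
      _ ≤ _ := by
          refine add_le_add ?_ hE₂'
          rw [norm_sub_rev]; exact hE₁'
  have : Real.exp (-(2 * Real.pi) * Y M) ≤ err₁ M + err₂ M := by
    have h := hkey
    rw [← mul_add] at h
    exact le_of_mul_le_mul_left h hcard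
  linarith

/-- **Non-vanishing of the first moment for a `w_N`-eigenform** (the case `g = ε f` of
`exists_wildChars_twistedSymbolSum_ne_zero`): `f(-1/(Nτ)) = ε N τ² f(τ)`, `a₁ = 1`,
`|aₙ| ≤ C n^θ` with `θ < 2/3`, `p ∤ N`. [folklore] -/
theorem exists_wildChars_twistedSymbolSum_ne_zero_of_isFrickeEigen {ε : ℂ}
    (hW : IsFrickeEigen N f ε) (hpN : ¬ p ∣ N) {C θ : ℝ} (hC : 0 ≤ C) (hθ : 0 < θ)
    (hθ1 : θ < 2 / 3) (ha : ∀ n : ℕ, ‖cuspCoeff f n‖ ≤ C * (n : ℝ) ^ θ) (h1 : cuspCoeff f 1 = 1) :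
    ∃ m₀ : ℕ, ∀ m : ℕ, m₀ ≤ m → ∃ χ ∈ wildChars p m, twistedSymbolSum f χ ≠ 0 := by
  have hW' : IsFrickePair N f (⇑(ε • f)) := by
    rw [CuspForm.IsGLPos.coe_smul]; exact hW.isFrickePair
  have hcoef : ∀ n : ℕ, cuspCoeff (ε • f) n = ε * cuspCoeff f n := fun n ↦ by
    show (qExpansion 1 ⇑(ε • f)).coeff n = ε * (qExpansion 1 ⇑f).coeff n
    rw [CuspForm.IsGLPos.coe_smul,
      ModularForm.qExpansion_smul one_pos (one_mem_strictPeriods_Gamma0 (N := N)) ε f]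
    simp
  refine exists_wildChars_twistedSymbolSum_ne_zero f hW' hpN hC hθ hθ1 (mul_nonneg (norm_nonneg ε) hC)
    hθ (by linarith) ha (fun n ↦ ?_) h1
  rw [hcoef, norm_mul, mul_assoc]
  exact mul_le_mul_of_nonneg_left (ha n) (norm_nonneg ε)

end Final

end Literature.NumberTheory.EllipticCurves
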